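import Literature.NumberTheory.GaloisCohomology.Howard2004.DVRKolyvaginBoundClosingProofs
import Literature.NumberTheory.GaloisCohomology.Howard2004.DVRSelmerATorsionControlProofs
import Literature.Algebra.Module.PrimaryModuleCorankOneLayers
import HarnessLib

/-!
# Howard 2004, Theorem 1.6.1 — the ASSEMBLY: the full conclusion record `DVRSetting.Conclusion`
# ((i) ∧ (ii) ∧ (iii)) from the levelwise package and the control of the `𝔪^{e_k}`-torsion of `H¹_F(K, A)`
# (arXiv:1202.6340, p. 12 L29–55) — proofs file

Source: B. Howard, *The Heegner point Kolyvagin system*, Compositio Math. **140** (2004), Thm. 1.6.1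
(= arXiv:1202.6340 Thm. 2.6.1, p. 11 L23–28; proof p. 12 L29–55).  The theorem is the CITE-ONLY named
fact `thm161_dvrKolyvaginBound` (`Howard2004/DVRKolyvaginBound.lean`; consumers: the μ-crux
`MuInequalityCoherentPair` of PrintX9 / PrintX10b, binder `stub_h161`).  This file ASSEMBLES its
conclusion record `DVRSetting.Conclusion hy κ.one` — (i) `H¹_F(K, T)` free of rank one, (ii) a finite `M`
with an additive `R`-equivariant bijection `H¹_F(K, A) ≅ 𝒟 ⊕ (M ⊕ M)`, (iii) `len_R M ≤ len_R(R/r₁R)`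
whenever `κ_1 = r₁ · x` — from:

* the levelwise package in its printed shape [p. 11 L33–38; Thm. 1.4.2 / Prop. 1.5.5]: ONE `ε ≤ 1` and
  additive `R`-equivariant bijections `θ_k : H¹_F(K, T^{(k)}) ≃ (Fin ε → R/𝔪^{e_k}) × (M_k × M_k)`,
  `M_k` finite; Lemma 1.6.4 at `n = 1` (`κ_1^{(k)} = π^{len M_k} · y_k`); `κ_1 ≠ 0`;
* the CONTROL of the torsion layers of `H¹_F(K, A)` [Lemma 1.3.3 = arXiv Lemma 2.3.3, p. 7 L152–160, as
  used at p. 12 L36–40: «`H¹_F(K, T^{(k)}) ≅ H¹_F(K, A[𝔪^k]) ≅ H¹_F(K, A)[𝔪^k]`»], taken as the HYPOTHESIS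
  `hctrl`: every class of `H¹_F(K, A)` killed by `π^{e_k}` is represented by a Selmer class of level `k`
  (the shape announced by the seat proving it, `bsd-line-x10b-p1-w2`, file `DVRLevelTorsionControlProofs`);
  the other half of the control — `H¹_F(K, T^{(k)}) → H¹_F(K, A)` is injective — is DERIVED here from
  `DVRSetting.incH1_injective` (`DVRLevelRaisingInjectiveProofs`);
* the tree's kernel theorems: `DVRKolyvaginBoundClosingProofs` (`ε = 1`, the uniform exponent,
  (i)+(iii) for `k ≫ 0`) and `Literature.Algebra.Module.PrimaryModuleCorankOneLayers` (w6: a `ϖ`-primary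
  module exhausted by injections with ranges the `ϖ^{e_k}`-torsion layers `≅ R/(ϖ^{e_k}) × F_k`, `F_k`
  uniformly bounded, is `≅ K/R × F_{k₀}`).

What is PROVED here (sorry-free, no definition, no named fact, no instance):

* §1 (generic tower) `AdicTower.incH1LE_injective_of_incH1_injective`, `AdicTower.of_injective_of_incH1_injective`
  (the level maps `H¹(K, T_j) → H¹(K, A)` are injective when the transitions are), and
  `AdicTower.of_mem_selmerA_of_mem_selmerGroup` (`[c] ∈ H¹_F(K, A)` for a Selmer class `c` of `F_j ≤ condA F j`);
* §3 **`DVRSetting.conclusion_of_package`** — `S.Conclusion hy κ.one` from the package ALONE: the control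
  hypothesis of §2 is discharged by `DVRSetting.mem_selmerA_and_map_pow_eq_zero_iff`
  (`DVRSelmerATorsionControlProofs`, Lemma 1.3.3 in the colimit);
* §2 **`DVRSetting.conclusion_of_package_of_control`** — `S.Conclusion hy κ.one`.  Inside the proof the
  `R`-module structure of `H¹(K, A)` (`r ↦ DirectLimit.map (H¹(r•))`, p664545 §3) and the `R`-submodule
  `H¹_F(K, A)` are installed LOCALLY (`letI`), the level structures are moved to the torsion layers through
  `hctrl`, and w6's exhaustion theorem is applied at a level `k₁ ≥ k₀` with `c ≤ e_{k₁}`; the module `M` of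
  (ii) is `M_{k₁}`, so (iii) is the levelwise bound of `DVRKolyvaginBoundClosingProofs` at `k₁`.

HONEST FRAMING: `thm161_dvrKolyvaginBound` is NOT proved here: it now follows from the levelwise package
(Thm. 1.4.2 / Prop. 1.5.5, Lemma 1.6.4 at `n = 1` — printed inputs, not in the tree) and the torsion-layer
control (Lemma 1.3.3 — a hypothesis in §2, DISCHARGED in §3).  No summit statement is proved; the
Birch–Swinnerton-Dyer conjecture is not proved by any of this.  No `sorry`, no new axiom, no instance, no
notation, no definition, no named fact.
-/

set_option autoImplicit false

noncomputable section

open Function NumberField IsDedekindDomain Field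
open scoped NumberField ContRepresentation Classical

namespace Literature.NumberTheory.GaloisCohomology.Howard2004

open Literature.NumberTheory.GaloisRepresentations
open Literature.NumberTheory.GaloisRepresentations.DiscreteGaloisModule

/-! ## §1 Generic tower facts: injective levels, Selmer classes map into `H¹_F(K, A)` -/

namespace AdicTower

variable {K : Type} [Field K] [NumberField K] {R : Type} [CommRing R] [IsLocalRing R]
  {N : ℕ → Type} [∀ k, AddCommGroup (N k)] [∀ k, TopologicalSpace (N k)] [∀ k, DiscreteTopology (N k)]
  [∀ k, Module R (N k)]
  (T : AdicTower K R N) (π : R) (e : ℕ → ℕ)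
  (hkill : ∀ k, ∀ r ∈ IsLocalRing.maximalIdeal R ^ e k, ∀ x : N k, r • x = 0)
  (hker : ∀ k, LinearMap.ker (T.red k) = (IsLocalRing.maximalIdeal R ^ e k) • (⊤ : Submodule R (N (k + 1))))
  (hπ : π ∈ IsLocalRing.maximalIdeal R) (he : ∀ k, e k ≤ e (k + 1))

omit [NumberField K] in
/-- The iterated transitions `incH1LE i l` are injective when every `H¹(inc_k)` is.
[cite: Howard2004HeegnerKolyvagin, Lemma 1.3.3 and §1.6 (arXiv p. 7 L152–160; p. 12 L36–46)] -/
theorem incH1LE_injective_of_incH1_injective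
    (hinj : ∀ k, Function.Injective (incH1 T π e hkill hker hπ he k)) (i : ℕ) :
    ∀ (l : ℕ) (h : i ≤ l), Function.Injective (incH1LE T π e hkill hker hπ he i l h) := by
  intro l h
  induction h with
  | refl =>
    have h0 : incH1LE T π e hkill hker hπ he i i le_rfl = AddMonoidHom.id _ := Nat.leRec_self _ _
    rw [h0]
    exact fun a b hab => hab
  | @step l hle ih =>
    have h1 : incH1LE T π e hkill hker hπ he i (l + 1) (Nat.le.step hle) =
        (incH1 T π e hkill hker hπ he l).comp (incH1LE T π e hkill hker hπ he i l hle) :=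
      Nat.leRec_succ _ _ hle
    rw [h1]
    exact (hinj l).comp ih

omit [NumberField K] in
/-- **The level maps `H¹(K, T_j) → H¹(K, A) = colim_k H¹(K, T_k)` are injective** when every transition
`H¹(inc_k)` is (a class dying in the colimit dies at a finite level, `DirectLimit.of.zero_exact`).
[cite: Howard2004HeegnerKolyvagin, Lemma 1.3.3 and Thm. 1.6.1, proof (arXiv p. 7 L152–160; p. 12 L36–46)] -/
theorem of_injective_of_incH1_injective
    (hinj : ∀ k, Function.Injective (incH1 T π e hkill hker hπ he k)) (j : ℕ) :
    Function.Injective (AddCommGroup.DirectLimit.of (fun k => galoisCohomology (T.ρ k) 1)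
      (incH1LE T π e hkill hker hπ he) j) := by
  haveI := directedSystem_incH1LE T π e hkill hker hπ he
  refine (injective_iff_map_eq_zero _).mpr fun c hc => ?_
  obtain ⟨l, hjl, hl⟩ := AddCommGroup.DirectLimit.of.zero_exact _ _ hc
  exact incH1LE_injective_of_incH1_injective T π e hkill hker hπ he hinj j l hjl (by rw [hl, map_zero])

/-- A Selmer class of `F_j` gives a class of `H¹_F(K, A)` (`F_j ≤ condA F j`, the `d = 0` term of the
propagated condition). [cite: Howard2004HeegnerKolyvagin, Thm. 1.6.1 (arXiv p. 11 L18–28; p. 12 L40–48)] -/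
theorem of_mem_selmerA_of_mem_selmerGroup (F : ∀ k, SelmerStructure (T.ρ k)) (j : ℕ)
    {c : galoisCohomology (T.ρ j) 1} (hc : c ∈ (F j).selmerGroup) :
    AddCommGroup.DirectLimit.of (fun k => galoisCohomology (T.ρ k) 1) (incH1LE T π e hkill hker hπ he) j c ∈
      selmerA T π e hkill hker hπ he F := by
  unfold selmerA
  refine AddSubgroup.mem_iSup_of_mem j ⟨c, ?_, rfl⟩
  exact selmerModule_mono (fun v => le_condA T π e hkill hker hπ he F j v) hc

end AdicTower

/-! ## §2 The assembly of `DVRSetting.Conclusion` -/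

namespace DVRSetting

variable {p : ℕ} [Fact p.Prime] {K : Type} [Field K] [NumberField K]
  {R : Type} [CommRing R] [IsDomain R] [IsDiscreteValuationRing R] [Algebra ℤ_[p] R]
  {N : ℕ → Type} [∀ k, AddCommGroup (N k)] [∀ k, TopologicalSpace (N k)]
  [∀ k, DiscreteTopology (N k)] [∀ k, Module R (N k)]
  {Rk : ℕ → Type} [∀ k, CommRing (Rk k)] [∀ k, IsLocalRing (Rk k)] [∀ k, TopologicalSpace (Rk k)]
  [∀ k, DiscreteTopology (Rk k)] [∀ k, Algebra ℤ_[p] (Rk k)] [∀ k, Algebra R (Rk k)]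
  [∀ k, Module (Rk k) (N k)] [∀ k, IsScalarTower R (Rk k) (N k)]
  {Nbar : Type} [AddCommGroup Nbar] [TopologicalSpace Nbar] [DiscreteTopology Nbar]
  [∀ k, Module (Rk k) Nbar]
  {Nq : ℕ → Finset (HeightOneSpectrum (𝓞 K)) → Type} [∀ k n, AddCommGroup (Nq k n)]
  [∀ k n, TopologicalSpace (Nq k n)] [∀ k n, DiscreteTopology (Nq k n)]
  [∀ k n, Module (Rk k) (Nq k n)] [∀ k n, Module R (Nq k n)]
  [∀ k n, IsScalarTower R (Rk k) (Nq k n)]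

/-- **Howard 2004, Thm. 1.6.1 — the conclusion record `DVRSetting.Conclusion` ((i) ∧ (ii) ∧ (iii)) ASSEMBLED
from the levelwise package and the control of the torsion layers of `H¹_F(K, A)`.**  On a `DVRSetting` with
H.0–H.5 and a Kolyvagin system with `κ_1 ≠ 0`, GIVEN (b) Thm. 1.4.2 / Prop. 1.5.5 levelwise in printed shape
(ONE `ε ≤ 1`; `θ_k : H¹_F(K, T^{(k)}) ≃ (Fin ε → R/𝔪^{e_k}) × (M_k × M_k)` additive `R`-equivariant, `M_k`
finite), (c) Lemma 1.6.4 at `n = 1` (`κ_1^{(k)} = π^{len M_k} · y_k`), and (CTRL) «`H¹_F(K, A)[𝔪^{e_k}]` is the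
image of `H¹_F(K, T^{(k)})`» (Lemma 1.3.3 in the colimit currency: every class of `H¹_F(K, A)` killed by
`π^{e_k}` — `π` acting by `DirectLimit.map (H¹(π^{e_k} •))` — is `[c]` for a level-`k` Selmer class `c`), THEN
`S.Conclusion hy κ.one` holds: (i) by `DVRKolyvaginBoundClosingProofs` (with the «Lemma 1.3.3 part» from
`DVRLevelRaisingInjectiveProofs`); «`ε = 1`» and a uniform exponent `c` are derived there; (ii) with
`M := M_{k₁}` for a level `k₁ ≥ k₀`, `e_{k₁} ≥ c`, by w6's
`nonempty_linearEquiv_fractionRingQuotient_prod_of_layers` applied to the `R`-module `H¹_F(K, A)` (its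
`R`-structure `r ↦ DirectLimit.map (H¹(r•))` installed inside the proof) exhausted by the injections
`(R/𝔪^{e_k}) × (M_k × M_k) ≅ H¹_F(K, T^{(k)}) ↪ H¹_F(K, A)` whose ranges are the `π^{e_k}`-torsion layers
(injective by `DVRSetting.incH1_injective`, onto the layer by (CTRL)); (iii) = the levelwise bound at `k₁`.
`thm161_dvrKolyvaginBound` is NOT proved here ((b), (c) are printed inputs; (CTRL) is a hypothesis).
[cite: Howard2004HeegnerKolyvagin, Thm. 1.6.1, proof (arXiv p. 11 L33–38; p. 12 L29–55)] -/
theorem conclusion_of_package_of_control (S : DVRSetting p K R N Rk Nbar Nq) (κ : S.KolyvaginSystem)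
    (hy : S.SatisfiesH) {ε : ℕ} (hε : ε ≤ 1)
    {M : ℕ → Type} [∀ k, AddCommGroup (M k)] [∀ k, Module R (M k)] [∀ k, Finite (M k)]
    (θ : ∀ k, ↥(((S.t k).cond).selmerGroup) ≃+
      ((Fin ε → R ⧸ IsLocalRing.maximalIdeal R ^ S.e k) × (M k × M k)))
    (hθ : ∀ k (r : R) (y : galoisCohomology (S.T.ρ k) 1) (hy' : y ∈ ((S.t k).cond).selmerGroup),
      θ k ⟨galoisCohomology.scalarMapH1 (S.T.ρ k) (S.T.hlin k) r y,
          S.scalarMapH1_mem_selmerGroup hy k r hy'⟩ = r • θ k ⟨y, hy'⟩)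
    (h164 : ∀ k, ∃ y ∈ ((S.t k).cond).selmerGroup,
      κ.one k = galoisCohomology.scalarMapH1 (S.T.ρ k) (S.T.hlin k)
        (S.π ^ (Module.length R (M k)).toNat) y)
    (hone : κ.one ≠ 0)
    (hctrl : ∀ (k : ℕ) (a : AdicTower.H1A S.T S.π S.e hy.killed hy.ker_red (S.π_mem_maximalIdeal hy)
        (S.e_le_succ hy)),
      a ∈ S.T.selmerA S.π S.e hy.killed hy.ker_red (S.π_mem_maximalIdeal hy) (S.e_le_succ hy)
        (fun k => (S.t k).cond) →
      (AddCommGroup.DirectLimit.map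
          (fun j => galoisCohomology.scalarMapH1 (S.T.ρ j) (S.T.hlin j) (S.π ^ S.e k))
          (AdicTower.scalarMapH1_comp_incH1LE S.T S.π S.e hy.killed hy.ker_red (S.π_mem_maximalIdeal hy)
            (S.e_le_succ hy) (S.π ^ S.e k)) a :
          AdicTower.H1A S.T S.π S.e hy.killed hy.ker_red (S.π_mem_maximalIdeal hy) (S.e_le_succ hy)) = 0 →
      ∃ c ∈ ((S.t k).cond).selmerGroup,
        AddCommGroup.DirectLimit.of (fun j => galoisCohomology (S.T.ρ j) 1)
          (AdicTower.incH1LE S.T S.π S.e hy.killed hy.ker_red (S.π_mem_maximalIdeal hy) (S.e_le_succ hy))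
          k c = a) :
    S.Conclusion hy κ.one := by
  have hπm : S.π ∈ IsLocalRing.maximalIdeal R := S.π_mem_maximalIdeal hy
  have hle : ∀ k, S.e k ≤ S.e (k + 1) := S.e_le_succ hy
  have hirr : Irreducible S.π := (IsDiscreteValuationRing.irreducible_iff_uniformizer S.π).mpr hy.unif
  -- (i) + (iii) for `k ≥ k₀`
  obtain ⟨x, hx, k₀, hbound⟩ := S.exists_isFreeRankOneOn_length_le_of_package' κ hy hε θ hθ h164 hone
  -- step 2: `ε = 1`; the level structures in the shape `R/𝔪^{e_k} × (M_k × M_k)`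
  have hε1 : ε = 1 := S.epsilon_eq_one_of_package κ hy hε θ hθ h164 hone
  subst hε1
  let Lk : ∀ k, ((Fin 1 → R ⧸ IsLocalRing.maximalIdeal R ^ S.e k) × (M k × M k)) ≃ₗ[R]
      ((R ⧸ IsLocalRing.maximalIdeal R ^ S.e k) × (M k × M k)) := fun k =>
    (LinearEquiv.funUnique (Fin 1) R _).prodCongr (LinearEquiv.refl R _)
  let θ' : ∀ k, ↥(((S.t k).cond).selmerGroup) ≃+
      ((R ⧸ IsLocalRing.maximalIdeal R ^ S.e k) × (M k × M k)) := fun k =>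
    (θ k).trans (Lk k).toAddEquiv
  have hθ' : ∀ k (r : R) (y : galoisCohomology (S.T.ρ k) 1) (hy' : y ∈ ((S.t k).cond).selmerGroup),
      θ' k ⟨galoisCohomology.scalarMapH1 (S.T.ρ k) (S.T.hlin k) r y,
          S.scalarMapH1_mem_selmerGroup hy k r hy'⟩ = r • θ' k ⟨y, hy'⟩ := by
    intro k r y hy'
    change Lk k (θ k ⟨_, _⟩) = r • Lk k (θ k ⟨y, hy'⟩)
    rw [hθ k r y hy', LinearEquiv.map_smul]
  -- step 3: one exponent kills every `M_k`; a level `k₁ ≥ k₀` with `c ≤ e_{k₁}`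
  obtain ⟨c, hc⟩ := S.exists_uniform_exponent_of_package κ hy θ' hθ' h164 hone
  have hek : ∀ m : ℕ, ∃ k, m ≤ S.e k := fun m => ⟨m, hy.e_strictMono.id_le m⟩
  set k₁ : ℕ := max k₀ c with hk₁
  have hck₁ : c ≤ S.e k₁ := (hy.e_strictMono.id_le c).trans (hy.e_strictMono.monotone (le_max_right _ _))
  -- notation for the colimit
  let G : ℕ → Type := fun j => galoisCohomology (S.T.ρ j) 1
  let f : ∀ i j : ℕ, i ≤ j → G i →+ G j := AdicTower.incH1LE S.T S.π S.e hy.killed hy.ker_red hπm hle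
  let of : ∀ j, G j →+ AddCommGroup.DirectLimit G f := fun j => AddCommGroup.DirectLimit.of G f j
  let sM : ∀ j, R → G j →+ G j := fun j r => galoisCohomology.scalarMapH1 (S.T.ρ j) (S.T.hlin j) r
  -- the scalars on `H¹(K, A)`: `r ↦ DirectLimit.map (H¹(r •))`
  let Ψ : R → (AddCommGroup.DirectLimit G f →+ AddCommGroup.DirectLimit G f) := fun r =>
    AddCommGroup.DirectLimit.map (fun j => sM j r)
      (AdicTower.scalarMapH1_comp_incH1LE S.T S.π S.e hy.killed hy.ker_red hπm hle r)
  have Ψof : ∀ (r : R) (j : ℕ) (y : G j), Ψ r (of j y) = of j (sM j r y) := fun r j y =>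
    AddCommGroup.DirectLimit.map_apply_of _ _ y
  letI instMod : Module R (AddCommGroup.DirectLimit G f) :=
    { smul := fun r a => Ψ r a
      one_smul := fun a => by
        change Ψ 1 a = a
        induction a using AddCommGroup.DirectLimit.induction_on with
        | ih j y =>
          rw [Ψof]
          change of j (galoisCohomology.scalarMapH1 (S.T.ρ j) (S.T.hlin j) 1 y) = of j y
          rw [galoisCohomology.scalarMapH1_one]
          rfl
      mul_smul := fun r s a => by
        change Ψ (r * s) a = Ψ r (Ψ s a)
        induction a using AddCommGroup.DirectLimit.induction_on with
        | ih j y =>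
          rw [Ψof, Ψof, Ψof]
          change of j (galoisCohomology.scalarMapH1 (S.T.ρ j) (S.T.hlin j) (r * s) y) = _
          rw [galoisCohomology.scalarMapH1_mul]
          rfl
      smul_zero := fun r => map_zero (Ψ r)
      smul_add := fun r a b => map_add (Ψ r) a b
      add_smul := fun r s a => by
        change Ψ (r + s) a = Ψ r a + Ψ s a
        induction a using AddCommGroup.DirectLimit.induction_on with
        | ih j y =>
          rw [Ψof, Ψof, Ψof, ← map_add]
          change of j (galoisCohomology.scalarMapH1 (S.T.ρ j) (S.T.hlin j) (r + s) y) = _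
          rw [galoisCohomology.scalarMapH1_add]
          rfl
      zero_smul := fun a => by
        change Ψ 0 a = 0
        induction a using AddCommGroup.DirectLimit.induction_on with
        | ih j y =>
          rw [Ψof]
          change of j (galoisCohomology.scalarMapH1 (S.T.ρ j) (S.T.hlin j) 0 y) = 0
          rw [galoisCohomology.scalarMapH1_zero, AddMonoidHom.zero_apply, map_zero] }
  have smul_def : ∀ (r : R) (a : AddCommGroup.DirectLimit G f), r • a = Ψ r a := fun _ _ => rfl
  -- `H¹_F(K, A)` as an `R`-submodule
  let SA : Submodule R (AddCommGroup.DirectLimit G f) :=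
    { carrier := S.T.selmerA S.π S.e hy.killed hy.ker_red hπm hle (fun k => (S.t k).cond)
      add_mem' := fun ha hb => add_mem ha hb
      zero_mem' := zero_mem _
      smul_mem' := fun r a ha => S.map_scalarMapH1_mem_selmerA hy hπm hle r ha }
  have memSA : ∀ {a : AddCommGroup.DirectLimit G f},
      a ∈ SA ↔ a ∈ S.T.selmerA S.π S.e hy.killed hy.ker_red hπm hle (fun k => (S.t k).cond) := Iff.rfl
  -- levels are killed by `π^{e_j}`
  have kill_of : ∀ (j : ℕ) (y : G j), Ψ (S.π ^ S.e j) (of j y) = 0 := fun j y => by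
    rw [Ψof]
    change of j (galoisCohomology.scalarMapH1 (S.T.ρ j) (S.T.hlin j) (S.π ^ S.e j) y) = 0
    rw [S.scalarMapH1_pow_eq_zero_of_le hy j le_rfl, map_zero]
  -- the inverse level structures are `R`-equivariant
  have symm_smul : ∀ (k : ℕ) (r : R) (y : (R ⧸ IsLocalRing.maximalIdeal R ^ S.e k) × (M k × M k)),
      (((θ' k).symm (r • y) : ↥(((S.t k).cond).selmerGroup)) : G k) =
        sM k r (((θ' k).symm y : ↥(((S.t k).cond).selmerGroup)) : G k) := by
    intro k r y
    have h := hθ' k r ((θ' k).symm y).1 ((θ' k).symm y).2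
    rw [Subtype.coe_eta, AddEquiv.apply_symm_apply] at h
    have h2 := congrArg (θ' k).symm h
    rw [AddEquiv.symm_apply_apply] at h2
    exact (congrArg Subtype.val h2).symm
  -- the injections `ι k : (R/𝔪^{e_k}) × (M_k × M_k) ≅ H¹_F(K, T^{(k)}) ↪ H¹_F(K, A)`
  have of_inj : ∀ j, Function.Injective (of j) := fun j =>
    AdicTower.of_injective_of_incH1_injective S.T S.π S.e hy.killed hy.ker_red hπm hle
      (fun k => S.incH1_injective hy hπm hle k) j
  let ι : ∀ k, ((R ⧸ IsLocalRing.maximalIdeal R ^ S.e k) × (M k × M k)) →ₗ[R] ↥SA := fun k =>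
    { toFun := fun y => ⟨of k ((θ' k).symm y).1,
        AdicTower.of_mem_selmerA_of_mem_selmerGroup S.T S.π S.e hy.killed hy.ker_red hπm hle
          (fun j => (S.t j).cond) k ((θ' k).symm y).2⟩
      map_add' := fun y z => by
        apply Subtype.ext
        change of k ((θ' k).symm (y + z)).1 = of k ((θ' k).symm y).1 + of k ((θ' k).symm z).1
        rw [map_add, AddSubgroup.coe_add, map_add]
      map_smul' := fun r y => by
        apply Subtype.ext
        change of k ((θ' k).symm (r • y)).1 = Ψ r (of k ((θ' k).symm y).1)
        rw [symm_smul, Ψof] }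
  have ι_val : ∀ (k : ℕ) (y : (R ⧸ IsLocalRing.maximalIdeal R ^ S.e k) × (M k × M k)),
      ((ι k y : ↥SA) : AddCommGroup.DirectLimit G f) = of k ((θ' k).symm y).1 := fun _ _ => rfl
  have hι : ∀ k, Function.Injective (ι k) := fun k y z h => by
    have h1 : of k ((θ' k).symm y).1 = of k ((θ' k).symm z).1 := by
      rw [← ι_val, ← ι_val, h]
    exact (θ' k).symm.injective (Subtype.ext (of_inj k h1))
  have hrange : ∀ k, LinearMap.range (ι k) = Submodule.torsionBy R (↥SA) (S.π ^ S.e k) := by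
    intro k
    ext a
    rw [LinearMap.mem_range, Submodule.mem_torsionBy_iff]
    constructor
    · rintro ⟨y, rfl⟩
      exact Subtype.ext (kill_of k _)
    · intro ha
      obtain ⟨c', hc', hca⟩ := hctrl k a.1 a.2 (congrArg Subtype.val ha)
      refine ⟨θ' k ⟨c', hc'⟩, Subtype.ext ?_⟩
      rw [ι_val, AddEquiv.symm_apply_apply]
      exact hca
  have hL : ∀ y : ↥SA, ∃ k, y ∈ LinearMap.range (ι k) := fun y => by
    obtain ⟨j, c', hjc⟩ := AdicTower.exists_of_eq S.T S.π S.e hy.killed hy.ker_red hπm hle y.1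
    refine ⟨j, ?_⟩
    rw [hrange, Submodule.mem_torsionBy_iff]
    apply Subtype.ext
    change Ψ (S.π ^ S.e j) y.1 = 0
    rw [← hjc]
    exact kill_of j c'
  -- w6's exhaustion theorem at the level `k₁`
  have hpow : ∀ n : ℕ, IsLocalRing.maximalIdeal R ^ n = Ideal.span {S.π ^ n} := fun n => by
    rw [hy.unif, Ideal.span_singleton_pow]
  obtain ⟨eL⟩ := Literature.Algebra.Module.nonempty_linearEquiv_fractionRingQuotient_prod_of_layers
    (L := ↥SA) hirr hek ι hι hrange hL (F := fun k => M k × M k) c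
    (fun k y => by rw [Prod.smul_mk, hc, hc, Prod.mk_zero_zero])
    (fun k => (Submodule.quotEquivOfEq _ _ (hpow (S.e k))).prodCongr (LinearEquiv.refl R _)) k₁ hck₁
  -- the additive bijection `Φ : H¹_F(K, A) ≃ 𝒟 × (M × M)` and its `R`-equivariance
  let Φ : ↥(S.T.selmerA S.π S.e hy.killed hy.ker_red hπm hle (fun k => (S.t k).cond)) ≃+
      (FracModR R × (M k₁ × M k₁)) :=
    { toFun := fun a => eL ⟨a.1, a.2⟩
      invFun := fun z => ⟨(eL.symm z).1, (eL.symm z).2⟩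
      left_inv := fun a => by
        apply Subtype.ext
        change ((eL.symm (eL ⟨a.1, a.2⟩) : ↥SA) : AddCommGroup.DirectLimit G f) = a.1
        rw [LinearEquiv.symm_apply_apply]
      right_inv := fun z => by
        change eL ⟨(eL.symm z).1, (eL.symm z).2⟩ = z
        rw [Subtype.coe_eta, LinearEquiv.apply_symm_apply]
      map_add' := fun a b => by
        change eL ⟨a.1 + b.1, _⟩ = eL ⟨a.1, a.2⟩ + eL ⟨b.1, b.2⟩
        rw [← map_add]
        rfl }
  have hΦ : ∀ (j : ℕ) (r : R) (c' : galoisCohomology (S.T.ρ j) 1)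
      (hc' : AddCommGroup.DirectLimit.of _ _ j c' ∈
        S.T.selmerA S.π S.e hy.killed hy.ker_red hπm hle (fun k => (S.t k).cond))
      (hrc : AddCommGroup.DirectLimit.of _ _ j (galoisCohomology.scalarMapH1 _ (S.T.hlin j) r c') ∈
        S.T.selmerA S.π S.e hy.killed hy.ker_red hπm hle (fun k => (S.t k).cond)),
      Φ ⟨_, hrc⟩ = r • Φ ⟨_, hc'⟩ := by
    intro j r c' hc' hrc
    change eL ⟨of j (sM j r c'), hrc⟩ = r • eL ⟨of j c', hc'⟩
    rw [← LinearEquiv.map_smul]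
    congr 1
    apply Subtype.ext
    change of j (sM j r c') = Ψ r (of j c')
    rw [Ψof]
  -- assemble
  refine ⟨x, hx, M k₁, inferInstance, inferInstance, inferInstance, Φ, hΦ, fun r₁ hr₁ => ?_⟩
  exact hbound k₁ (le_max_left _ _) r₁ hr₁

/-! ## §3 The torsion-layer control DISCHARGED (`DVRSelmerATorsionControlProofs`): `Conclusion` from the package alone -/

/-- **Howard 2004, Thm. 1.6.1 — the conclusion record `DVRSetting.Conclusion hy κ.one` ((i) ∧ (ii) ∧ (iii)) MODULO
EXACTLY the two printed inputs of §1.4–1.6** — Thm. 1.4.2 / Prop. 1.5.5 levelwise in printed shape (ONE `ε ≤ 1`;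
`θ_k : H¹_F(K, T^{(k)}) ≃ (Fin ε → R/𝔪^{e_k}) × (M_k × M_k)` additive `R`-equivariant, `M_k` finite) and Lemma 1.6.4
at `n = 1` (`κ_1^{(k)} = π^{len M_k} · y_k`) — for a `DVRSetting` with H.0–H.5 and a Kolyvagin system with
`κ_1 ≠ 0`: the torsion-layer control `hctrl` of `conclusion_of_package_of_control` («`H¹_F(K, A)[𝔪^{e_k}]` is the
image of `H¹_F(K, T^{(k)})`», Lemma 1.3.3 in the colimit) is SUPPLIED by
`DVRSetting.mem_selmerA_and_map_pow_eq_zero_iff` (`DVRSelmerATorsionControlProofs`, seat `bsd-line-x10b-p1-w2`),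
itself resting on the one-step control `DVRLevelTorsionControlProofs` (H.3 at `v ∈ Σ(F)`, «unramified cartesian»
off `Σ(F)`) and `condA F = F`.  After this theorem Lemma 1.3.3 is no longer an input of the tree's reduction of
`thm161_dvrKolyvaginBound`; the fact itself is NOT proved here (Thm. 1.4.2 / Prop. 1.5.5 and Lemma 1.6.4 remain
printed inputs: their printed proofs use Flach's generalized Cassels–Tate pairing, global duality and Čebotarev).
[cite: Howard2004HeegnerKolyvagin, Thm. 1.6.1, proof (arXiv p. 11 L33–38; p. 12 L29–55)] -/
theorem conclusion_of_package (S : DVRSetting p K R N Rk Nbar Nq) (κ : S.KolyvaginSystem)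
    (hy : S.SatisfiesH) {ε : ℕ} (hε : ε ≤ 1)
    {M : ℕ → Type} [∀ k, AddCommGroup (M k)] [∀ k, Module R (M k)] [∀ k, Finite (M k)]
    (θ : ∀ k, ↥(((S.t k).cond).selmerGroup) ≃+
      ((Fin ε → R ⧸ IsLocalRing.maximalIdeal R ^ S.e k) × (M k × M k)))
    (hθ : ∀ k (r : R) (y : galoisCohomology (S.T.ρ k) 1) (hy' : y ∈ ((S.t k).cond).selmerGroup),
      θ k ⟨galoisCohomology.scalarMapH1 (S.T.ρ k) (S.T.hlin k) r y,
          S.scalarMapH1_mem_selmerGroup hy k r hy'⟩ = r • θ k ⟨y, hy'⟩)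
    (h164 : ∀ k, ∃ y ∈ ((S.t k).cond).selmerGroup,
      κ.one k = galoisCohomology.scalarMapH1 (S.T.ρ k) (S.T.hlin k)
        (S.π ^ (Module.length R (M k)).toNat) y)
    (hone : κ.one ≠ 0) :
    S.Conclusion hy κ.one :=
  S.conclusion_of_package_of_control κ hy hε θ hθ h164 hone fun k a ha h0 =>
    (S.mem_selmerA_and_map_pow_eq_zero_iff hy (S.π_mem_maximalIdeal hy) (S.e_le_succ hy) k a).1 ⟨ha, h0⟩

end DVRSetting

end Literature.NumberTheory.GaloisCohomology.Howard2004
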